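import Summits.ValiantsHypothesis.ValiantsHypothesis.Theses.LiouvilleSarnak

/-!
# ValiantsHypothesis / LiouvilleSarnak — item `BilinearImpliesCutRank` (stmt-ValiantsHypothesis-14779), closed

`DigitalBilinearLiouville → LiouvilleCutRank` by the linear-algebra inequality
`rank(M) ≥ ‖M‖_F² / ‖M‖_op²` for the `±1` cut matrices `M_π`: with `G = Mᴴ M` (Hermitian, PSD,
`rank G ≤ rank M`), `tr G = Σ_{r,c} |M_rc|² = 4^n`, every eigenvalue of `G` is `‖M v‖²` for a unit
eigenvector `v`, hence `≤ ε·4^n` by the bilinear bound (tested with `u = conj(M v)`, `w = v`), and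
`tr G = Σ λ_i ≤ #{λ_i ≠ 0}·ε 4^n = rank(G)·ε 4^n`; so `1 ≤ ε·rank(M)`, i.e. `rank ≥ W + 1` at
`ε = 1/(W+1)`. Mathlib's matrix spectral theorem (`Matrix.IsHermitian.eigenvalues_eq`,
`trace_eq_sum_eigenvalues`, `rank_eq_card_non_zero_eigs`). HONEST FRAMING: bookkeeping;
`DigitalBilinearLiouville` is an OPEN conjecture-shaped crux; nothing here is progress on `VP ≠ VNP`.
-/

-- layout Summits/ValiantsHypothesis/ValiantsHypothesis forces the duplicated namespace component
set_option linter.dupNamespace false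

namespace Summit.ValiantsHypothesis.ValiantsHypothesis.Theorems.LiouvilleSarnak

open Matrix

/-- `star z ⬝ᵥ z = Σ_r ‖z_r‖²` over `ℂ`. [folklore] -/
private theorem star_dotProduct_self_eq {ι : Type*} [Fintype ι] (z : ι → ℂ) :
    star z ⬝ᵥ z = ((∑ r, ‖z r‖ ^ 2 : ℝ) : ℂ) := by
  rw [dotProduct, Complex.ofReal_sum]
  refine Finset.sum_congr rfl (fun r _ => ?_)
  rw [Pi.star_apply, Complex.star_def, Complex.conj_mul', Complex.ofReal_pow]

/-- **Rank versus Frobenius and operator norm** for a unimodular-entry matrix: if `|M_rc| = 1` for all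
`r, c` and `|uᵀ M w|² ≤ ε N² ‖u‖² ‖w‖²` for all `u, w` (`N = #ι > 0`), then `1 ≤ ε · rank M`.
[folklore] -/
theorem one_le_mul_rank_of_bilinear_bound {ι : Type*} [Fintype ι] [DecidableEq ι]
    (hι : 0 < Fintype.card ι) (M : Matrix ι ι ℂ) (hM1 : ∀ r c, ‖M r c‖ = 1) {ε : ℝ} (hε : 0 < ε)
    (hB : ∀ u w : ι → ℂ, ‖∑ r, ∑ c, u r * w c * M r c‖ ^ 2 ≤
      ε * (Fintype.card ι : ℝ) ^ 2 * (∑ r, ‖u r‖ ^ 2) * (∑ c, ‖w c‖ ^ 2)) :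
    (1 : ℝ) ≤ ε * M.rank := by
  -- Step 1: `‖M w‖² ≤ ε N² ‖w‖²`
  have hop : ∀ w : ι → ℂ, (∑ r, ‖(M *ᵥ w) r‖ ^ 2) ≤
      ε * (Fintype.card ι : ℝ) ^ 2 * ∑ c, ‖w c‖ ^ 2 := by
    intro w
    set z := M *ᵥ w with hz
    set S := ∑ r, ‖z r‖ ^ 2 with hS
    have hsum : ∑ r, ∑ c, star z r * w c * M r c = (S : ℂ) := by
      have hrow : ∀ r, ∑ c, star z r * w c * M r c = star (z r) * z r := by
        intro r
        simp_rw [mul_assoc, ← Finset.mul_sum]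
        congr 1
        rw [hz, mulVec, dotProduct]
        exact Finset.sum_congr rfl (fun c _ => mul_comm _ _)
      simp_rw [hrow]
      rw [hS, Complex.ofReal_sum]
      refine Finset.sum_congr rfl (fun r _ => ?_)
      rw [Complex.star_def, Complex.conj_mul', Complex.ofReal_pow]
    have h := hB (star z) w
    rw [hsum] at h
    have hu : ∑ r, ‖(star z) r‖ ^ 2 = S := by
      rw [hS]; exact Finset.sum_congr rfl (fun r _ => by rw [Pi.star_apply, norm_star])
    rw [hu, Complex.norm_real, Real.norm_of_nonneg (by positivity)] at h
    have hS0 : 0 ≤ S := by positivity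
    have hW0 : 0 ≤ ∑ c, ‖w c‖ ^ 2 := by positivity
    rcases hS0.eq_or_lt with h0 | hpos
    · rw [← h0]; positivity
    · have h' : S * S ≤ S * (ε * (Fintype.card ι : ℝ) ^ 2 * ∑ c, ‖w c‖ ^ 2) := by nlinarith
      exact le_of_mul_le_mul_left h' hpos
  -- Step 2: `G = Mᴴ M` is Hermitian with eigenvalues `≤ ε N²`
  have hH : (Mᴴ * M).IsHermitian := isHermitian_conjTranspose_mul_self M
  have hev : ∀ i, hH.eigenvalues i ≤ ε * (Fintype.card ι : ℝ) ^ 2 := by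
    intro i
    have hv1 : ∑ c, ‖(⇑(hH.eigenvectorBasis i) : ι → ℂ) c‖ ^ 2 = 1 := by
      have h1 := hH.eigenvectorBasis.orthonormal.1 i
      rw [EuclideanSpace.norm_eq, Real.sqrt_eq_one] at h1
      exact h1
    have hq : star (⇑(hH.eigenvectorBasis i) : ι → ℂ) ⬝ᵥ ((Mᴴ * M) *ᵥ ⇑(hH.eigenvectorBasis i)) =
        ((∑ r, ‖(M *ᵥ ⇑(hH.eigenvectorBasis i)) r‖ ^ 2 : ℝ) : ℂ) := by
      rw [← mulVec_mulVec, dotProduct_mulVec, vecMul_conjTranspose, star_star]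
      exact star_dotProduct_self_eq _
    rw [hH.eigenvalues_eq i, hq, RCLike.re_to_complex, Complex.ofReal_re]
    calc ∑ r, ‖(M *ᵥ ⇑(hH.eigenvectorBasis i)) r‖ ^ 2
        ≤ ε * (Fintype.card ι : ℝ) ^ 2 * ∑ c, ‖(⇑(hH.eigenvectorBasis i) : ι → ℂ) c‖ ^ 2 := hop _
      _ = ε * (Fintype.card ι : ℝ) ^ 2 := by rw [hv1, mul_one]
  -- Step 3: `tr G = N²`
  have htr : (Mᴴ * M).trace = (((Fintype.card ι : ℝ) ^ 2 : ℝ) : ℂ) := by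
    simp only [trace, diag_apply, mul_apply, conjTranspose_apply]
    have h1 : ∀ r c, star (M r c) * M r c = 1 := fun r c => by
      rw [Complex.star_def, Complex.conj_mul', hM1]; simp
    simp_rw [h1]
    simp only [Finset.sum_const, Finset.card_univ, nsmul_eq_mul, mul_one]
    push_cast; ring
  -- Step 4: `N² = Σ λ_i ≤ #{λ_i ≠ 0} · ε N² = rank(G) · ε N² ≤ rank(M) · ε N²`
  have hsumev : ∑ i, hH.eigenvalues i = (Fintype.card ι : ℝ) ^ 2 := by
    have h := hH.trace_eq_sum_eigenvalues
    rw [htr] at h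
    apply Complex.ofReal_injective
    push_cast at h ⊢
    exact h.symm
  have hle : ∑ i, hH.eigenvalues i ≤
      (Fintype.card {i // hH.eigenvalues i ≠ 0} : ℝ) * (ε * (Fintype.card ι : ℝ) ^ 2) := by
    calc ∑ i, hH.eigenvalues i
        ≤ ∑ i, (if hH.eigenvalues i ≠ 0 then ε * (Fintype.card ι : ℝ) ^ 2 else 0) := by
          refine Finset.sum_le_sum (fun i _ => ?_)
          split_ifs with h
          · exact hev i
          · exact (not_not.1 h).le
      _ = (Fintype.card {i // hH.eigenvalues i ≠ 0} : ℝ) * (ε * (Fintype.card ι : ℝ) ^ 2) := by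
          rw [Finset.sum_ite, Finset.sum_const_zero, add_zero, Finset.sum_const, nsmul_eq_mul,
            Fintype.card_subtype]
  have hrank : (Fintype.card {i // hH.eigenvalues i ≠ 0} : ℝ) ≤ M.rank := by
    rw [← hH.rank_eq_card_non_zero_eigs]
    exact_mod_cast Matrix.rank_mul_le_right Mᴴ M
  have hN : (0 : ℝ) < (Fintype.card ι : ℝ) ^ 2 := by positivity
  have key : (Fintype.card ι : ℝ) ^ 2 ≤ (M.rank : ℝ) * (ε * (Fintype.card ι : ℝ) ^ 2) :=
    calc (Fintype.card ι : ℝ) ^ 2 = ∑ i, hH.eigenvalues i := hsumev.symm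
      _ ≤ _ := hle
      _ ≤ (M.rank : ℝ) * (ε * (Fintype.card ι : ℝ) ^ 2) :=
          mul_le_mul_of_nonneg_right hrank (by positivity)
  nlinarith

/-- **Item `BilinearImpliesCutRank` (stmt-ValiantsHypothesis-14779):**
`DigitalBilinearLiouville → LiouvilleCutRank`. [folklore] -/
theorem bilinearImpliesCutRank_proof : Theses.LiouvilleSarnak.BilinearImpliesCutRank := by
  unfold Theses.LiouvilleSarnak.BilinearImpliesCutRank Theses.LiouvilleSarnak.DigitalBilinearLiouville
    Theses.LiouvilleSarnak.LiouvilleCutRank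
  intro hB W
  obtain ⟨n₀, hn₀⟩ := hB (1 / ((W : ℝ) + 1)) (by positivity)
  refine ⟨n₀, fun n hn π => ?_⟩
  set M : Matrix (Fin n → Bool) (Fin n → Bool) ℂ := Matrix.of fun r c : Fin n → Bool =>
    (((ArithmeticFunction.liouville (Nat.ofBits (fun j : Fin (2 * n) => Sum.elim r c (π.symm j)) + 1) : ℤ) : ℂ))
    with hM
  have hcard : (Fintype.card (Fin n → Bool) : ℝ) ^ 2 = 4 ^ n := by
    rw [Fintype.card_fun, Fintype.card_bool, Fintype.card_fin]
    push_cast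
    rw [← pow_mul, show (4 : ℝ) = 2 ^ 2 by norm_num, ← pow_mul, mul_comm]
  have hM1 : ∀ r c, ‖M r c‖ = 1 := by
    intro r c
    rw [hM, Matrix.of_apply, Complex.norm_intCast,
      ArithmeticFunction.liouville_apply (Nat.succ_ne_zero _)]
    push_cast
    rw [abs_pow, abs_neg, abs_one, one_pow]
  have h1 := one_le_mul_rank_of_bilinear_bound (ι := Fin n → Bool)
    (by rw [Fintype.card_fun, Fintype.card_bool, Fintype.card_fin]; positivity) M hM1
    (ε := 1 / ((W : ℝ) + 1)) (by positivity) (fun u w => by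
      rw [hcard]
      have h := hn₀ n hn π u w
      simpa only [hM, Matrix.of_apply] using h)
  -- `1 ≤ rank / (W + 1)` gives `W + 1 ≤ rank`
  have hW1 : (0 : ℝ) < (W : ℝ) + 1 := by positivity
  rw [one_div, ← div_eq_inv_mul, le_div_iff₀ hW1, one_mul] at h1
  exact_mod_cast (show ((W : ℝ)) ≤ M.rank by linarith)

end Summit.ValiantsHypothesis.ValiantsHypothesis.Theorems.LiouvilleSarnak
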